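import Summits.QuantumFields.YangMills.Theorems.HypercubicLimit.Negative.TelescopingGuards
import HarnessLib

/-!
# Crux `HypercubicLimit` (stmt-QuantumFields-16154), line `peel-and-disseminate`: the blanket product bound at `n = 2`

Support file (`--supports stmt-QuantumFields-16154`) proving the registered sub-goal `blanketProduct_two` of the
line `peel-and-disseminate` (skeleton `Cruxes/HypercubicLimit/Lines/peel_and_disseminate.lean`): the BLANKET
PRODUCT BOUND (F′) for two plaquettes with constant `C = 1`, unconditionally in `β, S, λ, R` and the positions.
With `μ` Wilson's measure on the torus of side `2S+1`, `Zₖ := E[δpₖ | exterior of Q_R(xₖ)]` and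
`Yₖ := E[|Zₖ| | exterior of Q_{λR}(xₖ)]`,
`E[Y₀ Y₁] ≤ ‖Y₀‖₂ ‖Y₁‖₂ ≤ ‖Z₀‖₂ ‖Z₁‖₂ = influence₀(2) · influence₁(2)`:
Cauchy–Schwarz (Hölder with exponents `(2, 2, 1)` on `eLpNorm`) and the `L²`-contractivity of conditional
expectation (`eLpNorm_condExp_le_eLpNorm`); the norms are finite because the centred plaquettes are bounded by
`2N` (`abs_centred_torusPlaquette_le`) and `μ` is a probability measure.

Refs: Williams 1991 §9.7–9.8 (conditional expectation as an `Lᵖ` contraction, conditional Jensen); card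
`Cruxes/HypercubicLimit/Ideas/peel-and-disseminate.md`.
-/

set_option autoImplicit false

noncomputable section

open scoped ENNReal
open MeasureTheory Filter Topology
open Literature.MathematicalPhysics.AQFT Literature.MathematicalPhysics.QuantumLattice
open Literature.MathematicalPhysics.QuantumFieldTheory
open Literature.Probability.LatticeModels (box Site)
open Summit.QuantumFields.YangMills.Theorems.HypercubicLimit.Negative (torusPlaquette rpSquare influence exterior
  cubeEdgesT measurable_torusPlaquette abs_centred_torusPlaquette_le)

namespace Summit.QuantumFields.YangMills.Cruxes.HypercubicLimit.PeelAndDisseminate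

/-! ## Cauchy–Schwarz through two conditional expectations -/

/-- **Cauchy–Schwarz through two conditional expectations.**  For real `f, g` with finite `L²(μ)` seminorm and
any two σ-algebras `m₁, m₂`, `∫ E[|f| | m₁] · E[|g| | m₂] dμ ≤ ‖f‖₂ ‖g‖₂`: Hölder with exponents `(2, 2, 1)`
and the contractivity `‖E[h | m]‖₂ ≤ ‖h‖₂ = ‖|h|‖₂` of conditional expectation (Williams 1991 §9.7,
conditional Jensen). [folklore] -/
theorem integral_condExp_abs_mul_condExp_abs_le {Ω : Type*} (m₁ m₂ : MeasurableSpace Ω) {m₀ : MeasurableSpace Ω}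
    {μ : Measure Ω} (f g : Ω → ℝ) (hf : eLpNorm f 2 μ ≠ ∞) (hg : eLpNorm g 2 μ ≠ ∞) :
    ∫ ω, (μ[fun ω => |f ω| | m₁]) ω * (μ[fun ω => |g ω| | m₂]) ω ∂μ ≤
      (eLpNorm f 2 μ).toReal * (eLpNorm g 2 μ).toReal := by
  -- `L²`-contractivity of conditional expectation, and `‖|h|‖₂ = ‖h‖₂`
  have hFle : eLpNorm (μ[fun ω => |f ω| | m₁]) 2 μ ≤ eLpNorm f 2 μ :=
    (eLpNorm_condExp_le_eLpNorm _ one_le_two).trans_eq (eLpNorm_norm f)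
  have hGle : eLpNorm (μ[fun ω => |g ω| | m₂]) 2 μ ≤ eLpNorm g 2 μ :=
    (eLpNorm_condExp_le_eLpNorm _ one_le_two).trans_eq (eLpNorm_norm g)
  have hFm : AEStronglyMeasurable (μ[fun ω => |f ω| | m₁]) μ := integrable_condExp.aestronglyMeasurable
  have hGm : AEStronglyMeasurable (μ[fun ω => |g ω| | m₂]) μ := integrable_condExp.aestronglyMeasurable
  generalize μ[fun ω => |f ω| | m₁] = F at hFle hFm ⊢
  generalize μ[fun ω => |g ω| | m₂] = G' at hGle hGm ⊢
  have hFne : eLpNorm F 2 μ ≠ ∞ := ne_top_of_le_ne_top hf hFle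
  have hGne : eLpNorm G' 2 μ ≠ ∞ := ne_top_of_le_ne_top hg hGle
  -- Hölder `(2, 2, 1)`
  have hH : eLpNorm (fun ω => F ω * G' ω) 1 μ ≤ eLpNorm F 2 μ * eLpNorm G' 2 μ := by
    have h := eLpNorm_le_eLpNorm_mul_eLpNorm'_of_norm (p := 2) (q := 2) (r := 1) hFm hGm (· * ·) 1
      (ae_of_all _ fun ω => by rw [norm_mul, NNReal.coe_one, one_mul])
    simpa only [ENNReal.coe_one, one_mul] using h
  calc ∫ ω, F ω * G' ω ∂μ ≤ ‖∫ ω, F ω * G' ω ∂μ‖ := Real.le_norm_self _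
    _ ≤ ∫ ω, ‖F ω * G' ω‖ ∂μ := norm_integral_le_integral_norm _
    _ = (eLpNorm (fun ω => F ω * G' ω) 1 μ).toReal := by
      rw [integral_norm_eq_lintegral_enorm (f := fun ω => F ω * G' ω) (hFm.mul hGm),
        eLpNorm_one_eq_lintegral_enorm]
    _ ≤ (eLpNorm F 2 μ * eLpNorm G' 2 μ).toReal := ENNReal.toReal_mono (ENNReal.mul_ne_top hFne hGne) hH
    _ = (eLpNorm F 2 μ).toReal * (eLpNorm G' 2 μ).toReal := ENNReal.toReal_mul
    _ ≤ (eLpNorm f 2 μ).toReal * (eLpNorm g 2 μ).toReal :=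
      mul_le_mul (ENNReal.toReal_mono hf hFle) (ENNReal.toReal_mono hg hGle) ENNReal.toReal_nonneg
        ENNReal.toReal_nonneg

/-! ## The registered stub -/

/-- **blanketProduct_two** — the BLANKET PRODUCT BOUND (F′) of the line `peel-and-disseminate` at `n = 2` with
constant `1`, unconditionally: for every compact gauge group with lattice representation data `r`, real `β`,
torus half-side `S`, blow-up factor `λ`, radius `R`, and two plaquettes of orientations `o k` at base points
`x k`, the expectation of the product of the conditional first moments `Yₖ = E[|Zₖ| | ext Q_{λR}(x k)]` of the
absolute conditional means `Zₖ = E[δpₖ | ext Q_R(x k)]` of the centred plaquettes is at most the product of the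
`L²` influence norms `‖Zₖ‖₂ = influence r β S R (x k) (o k).1 (o k).2 2`.  Proof: Cauchy–Schwarz and the
`L²`-contractivity of conditional expectation (`integral_condExp_abs_mul_condExp_abs_le`); the centred plaquettes
are bounded by `2N`, so every seminorm is finite. [folklore] -/
theorem blanketProduct_two :
    ∀ (G : Type) [Group G] [TopologicalSpace G] [IsTopologicalGroup G] [CompactSpace G]
        [MeasurableSpace G] [BorelSpace G] (r : LatticeRep G) (β : ℝ) (S lam R : ℕ)
        (o : Fin 2 → Fin 4 × Fin 4) (x : Fin 2 → Site 4),
      ∫ U, ∏ k, ((wilsonMeasure r.ρ β : Measure (GaugeConfig 4 (2 * S + 1) G))[fun U =>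
          |((wilsonMeasure r.ρ β : Measure (GaugeConfig 4 (2 * S + 1) G))[fun U =>
              torusPlaquette r (2 * S + 1) (o k).1 (o k).2 (x k) U -
                ∫ V, torusPlaquette r (2 * S + 1) (o k).1 (o k).2 (x k) V
                  ∂(wilsonMeasure r.ρ β : Measure (GaugeConfig 4 (2 * S + 1) G)) |
            (exterior (2 * S + 1) R (x k) : MeasurableSpace (GaugeConfig 4 (2 * S + 1) G))]) U| |
          (exterior (2 * S + 1) (lam * R) (x k) : MeasurableSpace (GaugeConfig 4 (2 * S + 1) G))]) U
        ∂(wilsonMeasure r.ρ β : Measure (GaugeConfig 4 (2 * S + 1) G)) ≤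
      ∏ k, influence r β S R (x k) (o k).1 (o k).2 2 := by
  intro G _ _ _ _ _ _ r β S lam R o x
  haveI := isProbabilityMeasure_wilsonMeasure (d := 4) (L := 2 * S + 1) r.ρ r.continuous β
  -- the centred plaquettes are bounded by `2N`, hence their conditional means have finite `L²` seminorm
  have hZ : ∀ k, eLpNorm ((wilsonMeasure r.ρ β : Measure (GaugeConfig 4 (2 * S + 1) G))[fun U =>
      torusPlaquette r (2 * S + 1) (o k).1 (o k).2 (x k) U -
        ∫ V, torusPlaquette r (2 * S + 1) (o k).1 (o k).2 (x k) V
          ∂(wilsonMeasure r.ρ β : Measure (GaugeConfig 4 (2 * S + 1) G)) |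
      (exterior (2 * S + 1) R (x k) : MeasurableSpace (GaugeConfig 4 (2 * S + 1) G))]) 2
      (wilsonMeasure r.ρ β : Measure (GaugeConfig 4 (2 * S + 1) G)) ≠ ∞ := by
    intro k
    refine ne_top_of_le_ne_top ?_ (eLpNorm_condExp_le_eLpNorm _ one_le_two)
    refine (MemLp.of_bound (p := 2) ?_ (2 * (r.N : ℝ)) (ae_of_all _ fun U => ?_)).eLpNorm_ne_top
    · exact ((measurable_torusPlaquette r _ _ _ _).sub measurable_const).aestronglyMeasurable
    · rw [Real.norm_eq_abs]
      exact abs_centred_torusPlaquette_le r _ _ _ _ _ U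
  simp only [Fin.prod_univ_two]
  exact integral_condExp_abs_mul_condExp_abs_le _ _ _ _ (hZ 0) (hZ 1)

end Summit.QuantumFields.YangMills.Cruxes.HypercubicLimit.PeelAndDisseminate

end
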